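import Mathlib
import Literature.Geometry.Lorentzian.KerrSurfaceGravity

/-!
# Sketch — crux-ideate `CaptureSufficesC2` (stmt-FinalStateConjecture-14986), ideator 2, round 1

First lemmas of the two idea cards, stated over Mathlib + `Literature.Geometry.Lorentzian.Kerr.*`
(no sorry; statements are `def … : Prop`, two sanity lemmas are proved).

* Card `redshift-launders-the-collapse` — LINEAR PILOT of its Stub B (interior red-shift softening
  at EVERY transversal order): for a mode `ψ(v, r)` of the scalar wave equation on Schwarzschild in
  ingoing Eddington–Finkelstein coordinates `g = −(1 − 2M/r)dv² + 2 dv dr + r²dω²` (the Kerr–Schild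
  leaf time is `t* = v − r`), the horizon jets `aₙ(v) = ∂ᵣⁿψ(v, 2M)` obey the triangular hierarchy
  `ȧₙ₊₁ = −(n+1)κ aₙ₊₁ − [(n(n+1) − L)/(8M²)] aₙ − [(2n+1)/(2M)] ȧₙ − [n²/(4M²)] ȧₙ₋₁`, `κ = 1/(4M)`,
  `L = ℓ(ℓ+1)` — obtained by applying `∂ᵣⁿ` to `r²□ψ = 2r²ψ_{vr} + 2rψ_v + ∂ᵣ((r² − 2Mr)ψᵣ) − Lψ = 0`
  at `r = 2M` (hand computation in NOTES.md; the diagonal rate `(n+1)κ` is the "enhanced red-shift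
  under commutation" of Dafermos–Rodnianski arXiv:0811.0354 §7). On an extremal horizon `κ = 0` and
  the diagonal vanishes (Aretakis conservation) — the lever needs `κ > 0`.
* Card `horizon-is-the-bounded-orbit` — scalar shadow of the horizon-normalisation lemma: for
  `ẋ = κx + f` with `κ > 0` the bounded solution is unique (PROVED for the homogeneous part:
  `bounded_orbit_linear_unique`) and is the graph `x(t) = −∫ₜ^∞ e^{−κ(s−t)} f(s) ds`, `|x| ≤ κ⁻¹ sup|f|`.
-/

-- the problem namespace `FinalStateConjecture.FinalStateConjecture` (single-conjunct summit) trips dupNamespace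
set_option linter.dupNamespace false

noncomputable section

open Filter Topology Set

namespace Summit.FinalStateConjecture.FinalStateConjecture.Cruxes.CaptureSufficesC2.Ideator2

/-! ## Card 1 — the transversal-jet red-shift hierarchy (scalar pilot of Stub B) -/

/-- `r² □_g ψ` for a fixed angular mode `L = ℓ(ℓ+1)` of `ψ(v, r)` on Schwarzschild(`M`) in ingoing
Eddington–Finkelstein coordinates: `2r² ψ_{vr} + 2r ψ_v + ∂ᵣ((r² − 2Mr) ψᵣ) − L ψ`. -/
def efModeOp (M L : ℝ) (ψ : ℝ → ℝ → ℝ) (v r : ℝ) : ℝ :=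
  2 * r ^ 2 * deriv (fun v' ↦ deriv (ψ v') r) v + 2 * r * deriv (fun v' ↦ ψ v' r) v
    + deriv (fun r' ↦ (r' ^ 2 - 2 * M * r') * deriv (ψ v) r') r - L * ψ v r

/-- The `n`-th transversal (`∂ᵣ`) jet of `ψ` on the future event horizon `r = 2M`, as a function of
advanced time `v`. -/
def horizonJet (M : ℝ) (ψ : ℝ → ℝ → ℝ) (n : ℕ) (v : ℝ) : ℝ :=
  iteratedDeriv n (ψ v) (2 * M)

/-- Diagonal rate of the `n`-th jet: `n κ(M, 0)`. -/
def jetRate (M : ℝ) (n : ℕ) : ℝ := n * Literature.Geometry.Lorentzian.Kerr.surfaceGravity M 0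

/-- Sanity (PROVED): the diagonal rate is `n/(4M)`, i.e. the `n`-th transversal derivative is
red-shifted `n` times as fast as the first (`Kerr.surfaceGravity_zero_right`). -/
theorem jetRate_eq {M : ℝ} (hM : 0 ≤ M) (n : ℕ) : jetRate M n = n / (4 * M) := by
  unfold jetRate
  rw [Literature.Geometry.Lorentzian.Kerr.surfaceGravity_zero_right hM]
  ring

/-- FIRST LEMMA of card 1, order one (`n = 0 → 1`): along the Schwarzschild horizon the first
transversal derivative obeys `∂ᵥ(∂ᵣψ) = −κ ∂ᵣψ + (L/8M²) ψ − (1/2M) ∂ᵥψ`, `κ = 1/(4M)`.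
(The classical red-shift / Aretakis identity; at `κ = 0` the first term is absent.) -/
def JetRedShiftOrderOne : Prop :=
  ∀ (M L : ℝ), 0 < M → ∀ ψ : ℝ → ℝ → ℝ, ContDiff ℝ ⊤ (fun p : ℝ × ℝ ↦ ψ p.1 p.2) →
    (∀ v r, 0 < r → efModeOp M L ψ v r = 0) →
      ∀ v, deriv (horizonJet M ψ 1) v
          = -(jetRate M 1) * horizonJet M ψ 1 v
            + L / (8 * M ^ 2) * horizonJet M ψ 0 v - 1 / (2 * M) * deriv (horizonJet M ψ 0) v

/-- FIRST LEMMA of card 1, all orders: the triangular hierarchy with diagonal `−(n+1)κ`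
(for `n = 0` the last term vanishes since its coefficient is `0²`). -/
def JetRedShiftHierarchy : Prop :=
  ∀ (M L : ℝ), 0 < M → ∀ ψ : ℝ → ℝ → ℝ, ContDiff ℝ ⊤ (fun p : ℝ × ℝ ↦ ψ p.1 p.2) →
    (∀ v r, 0 < r → efModeOp M L ψ v r = 0) →
      ∀ (n : ℕ) (v : ℝ), deriv (horizonJet M ψ (n + 1)) v
          = -(jetRate M (n + 1)) * horizonJet M ψ (n + 1) v
            - ((n : ℝ) * (n + 1) - L) / (8 * M ^ 2) * horizonJet M ψ n v
            - (2 * (n : ℝ) + 1) / (2 * M) * deriv (horizonJet M ψ n) v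
            - (n : ℝ) ^ 2 / (4 * M ^ 2) * deriv (horizonJet M ψ (n - 1)) v

/-- Consequence the line uses (variation of constants): a solution of `J' = −κJ + f` with
`|f| ≤ A e^{−αv}`, `0 < α ≤ κ`, satisfies `|J(v)| ≤ (|J(0)| + A v) e^{−αv}` — so, inductively up the
hierarchy, EVERY transversal jet of a perturbation whose horizon trace decays exponentially decays
exponentially (rate limited by `κ`, never by the order). -/
def RedShiftODEDecay : Prop :=
  ∀ (κ α A : ℝ), 0 < α → α ≤ κ → 0 ≤ A → ∀ (J f : ℝ → ℝ), Continuous f →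
    (∀ v, HasDerivAt J (-κ * J v + f v) v) → (∀ v, 0 ≤ v → |f v| ≤ A * Real.exp (-α * v)) →
      ∀ v, 0 ≤ v → |J v| ≤ (|J 0| + A * v) * Real.exp (-α * v)

/-! ## Card 2 — the horizon is the bounded orbit (scalar shadow, homogeneous part PROVED) -/

/-- PROVED: for `κ > 0` the only solution of `ẋ = κ x` bounded on `[0, ∞)` is `x ≡ 0` — the
repelling (normally hyperbolic) character of a sub-extremal horizon for the outgoing null generator
flow `ṙ ≈ κ (r − r₊)`; uniqueness of the bounded orbit is what makes the event horizon a GRAPH. -/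
theorem bounded_orbit_linear_unique {κ B : ℝ} (hκ : 0 < κ) {x : ℝ → ℝ}
    (hx : ∀ t, HasDerivAt x (κ * x t) t) (hB : ∀ t, 0 ≤ t → |x t| ≤ B) : x 0 = 0 := by
  -- `y t = exp(-κ t) * x t` has zero derivative, hence is constant
  have hy : ∀ t, HasDerivAt (fun s ↦ Real.exp (-κ * s) * x s) 0 t := by
    intro t
    have h1 : HasDerivAt (fun s ↦ Real.exp (-κ * s)) (Real.exp (-κ * t) * (-κ)) t := by
      have hlin : HasDerivAt (fun s : ℝ ↦ -κ * s) (-κ) t := by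
        simpa using (hasDerivAt_id t).const_mul (-κ)
      exact (Real.hasDerivAt_exp (-κ * t)).comp t hlin
    have h2 : HasDerivAt (fun s ↦ Real.exp (-κ * s) * x s)
        (Real.exp (-κ * t) * (-κ) * x t + Real.exp (-κ * t) * (κ * x t)) t := h1.mul (hx t)
    have h3 : Real.exp (-κ * t) * (-κ) * x t + Real.exp (-κ * t) * (κ * x t) = 0 := by ring
    exact h3 ▸ h2
  have hconst : ∀ t, Real.exp (-κ * t) * x t = x 0 := by
    intro t
    have hdiff : Differentiable ℝ (fun s ↦ Real.exp (-κ * s) * x s) :=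
      fun s ↦ (hy s).differentiableAt
    have h := is_const_of_deriv_eq_zero hdiff (fun s ↦ (hy s).deriv) t 0
    simpa using h
  have hxt : ∀ t, x t = Real.exp (κ * t) * x 0 := by
    intro t
    have hone : Real.exp (κ * t) * Real.exp (-κ * t) = 1 := by
      rw [← Real.exp_add, show κ * t + -κ * t = 0 by ring, Real.exp_zero]
    calc x t = (Real.exp (κ * t) * Real.exp (-κ * t)) * x t := by rw [hone, one_mul]
      _ = Real.exp (κ * t) * (Real.exp (-κ * t) * x t) := by ring
      _ = Real.exp (κ * t) * x 0 := by rw [hconst t]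
  by_contra h0
  have hx0 : 0 < |x 0| := abs_pos.mpr h0
  have hB0 : 0 ≤ B := le_trans (abs_nonneg _) (hB 0 le_rfl)
  -- pick `t = (B + 1) / (κ |x 0|)`: then `|x t| ≥ |x 0| (κ t + 1) = B + 1 + |x 0| > B`
  set t : ℝ := (B + 1) / (κ * |x 0|) with ht
  have htpos : 0 ≤ t := by positivity
  have hexp : κ * t + 1 ≤ Real.exp (κ * t) := by
    have := Real.add_one_le_exp (κ * t)
    linarith
  have habs : |x t| = Real.exp (κ * t) * |x 0| := by
    rw [hxt t, abs_mul, abs_of_pos (Real.exp_pos _)]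
  have hprod : κ * |x 0| * t = B + 1 := by
    rw [ht]; field_simp
  have hge : B + 1 ≤ |x t| := by
    rw [habs]
    have : (κ * t + 1) * |x 0| ≤ Real.exp (κ * t) * |x 0| :=
      mul_le_mul_of_nonneg_right hexp (le_of_lt hx0)
    nlinarith [this, hprod, hx0]
  have := hB t htpos
  linarith

/-- FIRST LEMMA of card 2 (scalar shadow of horizon normalisation): for `ẋ = κx + f(t, x)` with
`κ > 0`, `f` small-Lipschitz in `x` and `|f(t, ·)| ≤ ε(t) → 0`, there is EXACTLY ONE solution bounded
on `[0, ∞)`, and it satisfies `|x(t)| ≤ (2/κ)·sup_{s ≥ t} ε(s)` — the event horizon as the unique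
non-escaping, non-plunging outgoing null generator, a `C¹` graph over `r = r₊` within `κ⁻¹·(deviation)`.
-/
def BoundedOrbitGraph : Prop :=
  ∀ (κ : ℝ), 0 < κ → ∀ (f : ℝ → ℝ → ℝ) (ε : ℝ → ℝ), Continuous (fun p : ℝ × ℝ ↦ f p.1 p.2) →
    Antitone ε → Tendsto ε atTop (𝓝 0) → (∀ t x, |f t x| ≤ ε t) →
    (∀ t x y, |f t x - f t y| ≤ κ / 2 * |x - y|) →
      (∃ x : ℝ → ℝ, (∀ t, HasDerivAt x (κ * x t + f t (x t)) t) ∧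
          (∀ t, 0 ≤ t → |x t| ≤ 2 / κ * ε t)) ∧
      (∀ x y : ℝ → ℝ, (∀ t, HasDerivAt x (κ * x t + f t (x t)) t) →
          (∀ t, HasDerivAt y (κ * y t + f t (y t)) t) →
          BddAbove (range fun t : Ici (0:ℝ) ↦ |x t|) → BddAbove (range fun t : Ici (0:ℝ) ↦ |y t|) →
            x = y)

end Summit.FinalStateConjecture.FinalStateConjecture.Cruxes.CaptureSufficesC2.Ideator2

end
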